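import Summits.BirchSwinnertonDyer.BirchSwinnertonDyer.Theorems.KolyvaginRoadThreeKernelHL
import Summits.BirchSwinnertonDyer.BirchSwinnertonDyer.Theorems.KolyvaginRoadThreeLevelData
import Summits.BirchSwinnertonDyer.Rank1Residual.X11b.Three.KolyvaginNonvanishing
import Summits.BirchSwinnertonDyer.Rank1Residual.X11b.BDPRouteRigidity
import Summits.BirchSwinnertonDyer.Rank1Residual.X11b.BDPRouteOpenInputTight
import Summits.BirchSwinnertonDyer.Rank1Residual.X11b.BDPRouteOddPrime
import Summits.BirchSwinnertonDyer.Rank1Residual.X11b.BDPRouteManin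
import Summits.BirchSwinnertonDyer.Rank1Residual.X11b.HeegnerPointScaling
import Summits.BirchSwinnertonDyer.Rank1Residual.X11b.ChaRoute
import Summits.BirchSwinnertonDyer.Rank1Residual.X11b.BDPRouteTamagawaSupport
import Literature.NumberTheory.EllipticCurves.SkinnerZhang2014.KolyvaginNonvanishing
import Literature.NumberTheory.EllipticCurves.BSDHeegnerPointsTorsionProofs
import Literature.NumberTheory.EllipticCurves.BSDSelmerPConverseRamifiedProofs
import Literature.NumberTheory.EllipticCurves.BSDSelmerSkinnerProofs
import Literature.NumberTheory.EllipticCurves.HeegnerPointsOfConductorRationalityProofs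
import Literature.NumberTheory.EllipticCurves.RingClassGalOverCyclicProofs
import Literature.NumberTheory.EllipticCurves.HeegnerPointsClassesProofs
import Literature.NumberTheory.EllipticCurves.HeegnerPointsRationalityProofs
import Literature.NumberTheory.EllipticCurves.Rank1Residual.ClassX1KellerYin
import Literature.NumberTheory.EllipticCurves.Rank1Residual.ClassX1KellerYinTypeA
import Literature.NumberTheory.EllipticCurves.Rank1Residual.X9NoEntry
import Literature.NumberTheory.EllipticCurves.RootNumberEvenAnalyticRankProofs
import Literature.NumberTheory.EllipticCurves.GlobalMinimalModelProofs
import Literature.NumberTheory.EllipticCurves.NeronIsogenyScalingHoldsProofs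
import Literature.NumberTheory.DiophantineGeometry.AbcWave0GranvilleStarkTheorem2Proofs
import HarnessLib

/-!
# Rung K2 at `p ≥ 5` (class X11b, board atom B9): Skinner–Zhang 2014 **Thm. 1.3** (Kolyvagin
# non-vanishing mod `p` at `p ∥ N`) BY LITERATURE NAME + McCallum 1991 + published inputs ⟹ `BSD(E,p)`
# — the Manin-constant gap between the ∃-framed Literature statement and the tree's Manin-good frames
# closed by a scaling lemma (cell `bsd-stepL`, seat `bsd-stepL-mult-p3`, session g0;
# `--supports stmt-BirchSwinnertonDyer-19703`)

HONEST FRAMING (cell `bsd-stepL`, HOME `run/shared/lean/pub/bsd-stepL/`): CONDITIONAL on the OPEN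
Literature binder `SkinnerZhang2014.thm1_3_exists_kolyvaginClass_one_ne_zero_OPEN` (arXiv:1407.1099v1
Thm. 1.3 at `N⁻ = 1`; UNREFEREED since 2014; `[claim: SkinnerZhang2014, status: under-review]`) and on
the named fact `McCallum1991_pow_dvd_card_sha_primary_of_certificate` (LINE-K) plus the cell's standing
PUBLISHED inputs (Gross–Zagier, Kolyvagin ×2, Skinner 2016 Thm. C for the twist, GZK, modularity ×2,
Hoffstein–Luo, Mazur's Manin constant, Shimura reciprocity at conductor 1). Nothing is booked; X11b
stays CONSTRUCTION-SHAPED (T7); BSD is proved for no curve unconditionally.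

WHY THIS FILE. The tree's by-name chain from SZ14 **Thm. 1.3** stops at STEP L for the WITNESS frame:
`Koly.exists_indexLowerBoundAt_of_skinnerZhang2014_of_mccallum` (koly g6) concludes `IndexLowerBoundAt
W p K P` for the Heegner point `P = y_K` of the parametrisation datum `Dt` that the ∃-typed Literature
statement produces — "the descent `IndexLowerBoundAt → BSDp` is `bsdp_of_indexLowerBoundAt_of_heegnerData_of_odd`
(not composed here)" (`ErratumRoadFiveKolyvaginRoad.lean`). It CANNOT be composed as typed: the rigidity
theorem needs `¬ p ∣ Dt.c` (a Manin-good frame), and the Literature statement gives no control over the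
Manin-constant FIELD `Dt.c` of its witness (the datum type is not rigid: `Dt.zsmul m`,
`ModularParametrizationScalingProofs`). This file closes the gap with one observation: two data `Dt, Dt'`
of `W` at level `N` have PROPORTIONAL Heegner points, `Dt'.c • P_{Dt,H} = Dt.c • P_{Dt',H}`
(`ModularParametrizationData.zsmul_heegnerPointComplex_eq`, b2b lit g14), and the STEP-L inequality
`2·ord_p[E(K):ℤP] ≤ ord_p #Ш(E/K) + 2·ord_p ∏c` is MONOTONE under `P ↦ (c'/c)·P` when `p ∤ c`
(`index_zmultiples_zsmul`): STEP L at the witness point implies STEP L at the Heegner point of ANY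
Manin-good datum with the SAME orientation `β` and embedding `ι` (§1), and such a datum exists (Mazur +
minimal parametrisation, `exists_modularParametrizationData_not_dvd`). So (§2):

* `Koly.indexLowerBoundAt_of_zsmul_eq_zsmul` — STEP-L transport between proportional points.
* `Koly.openInputOnTreeAt_of_skinnerZhang13_OPEN_of_mccallum_of_control` (§3) — the same in route p2's currency
  `P2OpenInputOnTreeAt W p`, given the PUB-shaped control identity `P2ControlOnTreeAt W p` (tightness).
* `Koly.bsdp_of_skinnerZhang13_OPEN_of_mccallum` — for `(E,p) ∈` X11b, `p ≥ 5`, `ρ̄` not finite at `p`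
  (+ the split `𝓛`-clause), Hypothesis ♠ at `N⁻ = 1` (every multiplicative `ℓ ≠ p` E[p]-ramified, and one
  exists) and `p ∤ ∏ c_ℓ`: **`BSDp W p` from SZ14 Thm. 1.3 BY NAME** + McCallum + published inputs. The field
  is the Hoffstein–Luo admissible field (`d_K` odd, `< −4`, Heegner for `N` and `p`, `L(E^{d_K},1) ≠ 0`);
  the witness frame's `β'` is kept (a Heegner datum with residue `β'`, `exists_heegnerDatum`), only `Dt` is
  moved to a Manin-good one.
Compared with `Rank1Residual.bsdp_of_skinnerZhang_OPEN` (b2b; SZ14 **Thm. 1.2** = the BSD-formula CLAIM by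
name) this replaces the claim by the paper's Kolyvagin-system input Thm. 1.3 and the PUBLISHED descent
(McCallum 1991 Cor. 5.6 + Gross–Zagier + Skinner Thm. C), as the cell's memo chain reads SZ14 §§3–11.

References: [SkinnerZhang2014] Thm. 1.3 (§1); [McCallumLMS1991] §5 Cor. 5.6; [WZhang2014] Remark 5,
Thm. 10.2; [GrossZagier1986] I (6.3), V (2.2); [Skinner2016PacificMC] Thm. C; [Mazur1978] Cor. 4.1;
[Miller2011LMS] Def. 1.1.
-/

set_option autoImplicit false

noncomputable section

open scoped Classical

namespace Summit.BirchSwinnertonDyer.Rank1Residual.X11b.Three.Koly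

open WeierstrassCurve NumberField Literature.NumberTheory.EllipticCurves
  Literature.NumberTheory.EllipticCurves.ModularForms
  Literature.NumberTheory.EllipticCurves.Rank1Residual
  Summit.BirchSwinnertonDyer.Rank1Residual Summit.BirchSwinnertonDyer.Rank1Residual.X11b

/-! ### §1 STEP L is monotone between proportional points -/

/-- **STEP-L transport.** In `E(K)`, if `c' • P = c • P'` with `p ∤ c`, `c' ≠ 0` and `P`, `P'` of infinite
order, then `IndexLowerBoundAt W p K P'` implies `IndexLowerBoundAt W p K P`: by
`index_zmultiples_zsmul`, `|c'|·[E(K):ℤP] = [E(K):ℤ(c'P)] = [E(K):ℤ(cP')] = |c|·[E(K):ℤP']`, so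
`ord_p[E(K):ℤP] ≤ ord_p[E(K):ℤP']` (the index `0` = infinite index makes the target trivial).
Elementary. [cite: McCallumLMS1991, §5 (the index I_K)] -/
theorem indexLowerBoundAt_of_zsmul_eq_zsmul {W : WeierstrassCurve ℚ} {p : ℕ} [Fact p.Prime]
    {K : Type} [Field K] [NumberField K] {P P' : (W.baseChange K).toAffine.Point} {c c' : ℤ}
    (h : c' • P = c • P') (hc : ¬ (p : ℤ) ∣ c) (hc' : c' ≠ 0) (hPinf : ¬ IsOfFinAddOrder P)
    (hP'inf : ¬ IsOfFinAddOrder P') (hL : IndexLowerBoundAt W p K P') : IndexLowerBoundAt W p K P := by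
  unfold IndexLowerBoundAt at hL ⊢
  have h1 := index_zmultiples_zsmul hPinf c'
  have h2 := index_zmultiples_zsmul hP'inf c
  rw [h] at h1
  have hkey : c'.natAbs * (AddSubgroup.zmultiples P).index =
      c.natAbs * (AddSubgroup.zmultiples P').index := h1.symm.trans h2
  by_cases h0 : (AddSubgroup.zmultiples P).index = 0
  · rw [h0, padicValNat_zero_right]
    omega
  · have hc'0 : c'.natAbs ≠ 0 := Int.natAbs_ne_zero.mpr hc'
    have hne : c.natAbs * (AddSubgroup.zmultiples P').index ≠ 0 := by
      rw [← hkey]; exact mul_ne_zero hc'0 h0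
    have hc0 : c.natAbs ≠ 0 := fun h' ↦ hne (by rw [h', zero_mul])
    have hi' : (AddSubgroup.zmultiples P').index ≠ 0 := fun h' ↦ hne (by rw [h', mul_zero])
    have hv := congrArg (padicValNat p) hkey
    rw [padicValNat.mul hc'0 h0, padicValNat.mul hc0 hi'] at hv
    have hvc : padicValNat p c.natAbs = 0 :=
      padicValNat.eq_zero_of_not_dvd fun hd ↦ hc (Int.ofNat_dvd_left.mpr hd)
    omega

/-! ### §2 SZ14 Thm 1.3 BY NAME ⟹ `BSD(E,p)` -/

/-- **B9 at `p ≥ 5`: `BSD(E,p)` from Skinner–Zhang 2014 Thm. 1.3 (OPEN Literature binder, ∃-framed as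
printed at `N⁻ = 1`) + McCallum 1991 + the published inputs.** For `W/ℚ` globally minimal with
`(E,p) ∈` X11b (`r_an = 1`, `p ∥ N`, `E[p]` irreducible), `5 ≤ p`, `ρ̄_{E,p}` not finite at `p`
(`p ∤ v_p(Δ_min)`) with the split `𝓛`-clause, Hypothesis ♠ at `N⁻ = 1` (every multiplicative `ℓ ≠ p` has
`p ∤ v_ℓ(Δ_min)`; one such `ℓ` exists = (ram)) and `p ∤ ∏_ℓ c_ℓ(E)`: `BSDp W p`. Road: Hoffstein–Luo
admissible field `K` (`exists_admissibleField_of_rootNumber_eq_neg_one`) → SZ14 Thm. 1.3 at `K` gives a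
frame `(Dt', β', ι')` and `n ∈ Λ` with `c_1(n) ≠ 0` → McCallum's structure theorem at that frame
(`indexLowerBoundAt_of_kolyvaginClass_one_ne_zero_of_mccallum`: tower surjectivity from `Surj ∧ Ram`,
non-CM from `p ∥ N`, `E(K)[p] = 0` from irreducibility, rank one and finite `Ш(E/K)` from Kolyvagin at
the non-torsion Heegner point) → STEP L at the witness point `y_K^{(Dt',β',ι')}` → §1 transports it to
the Heegner point of a Manin-good datum `Dt` (`p ∤ Dt.c`, Mazur + minimal parametrisation) with the
same `β', ι'` → `bsdp_of_indexLowerBoundAt_of_heegnerData_of_odd` (Gross–Zagier + Kolyvagin 1990 +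
Skinner Thm. C for `E^{d_K}`). CONDITIONAL on `hSZ` (PRE claim) and `hMc`; nothing booked.
[claim: SkinnerZhang2014, status: under-review] [cite: McCallumLMS1991, §5 Cor. 5.6 (p. 310)]
[cite: WZhang2014, Remark 5 and Thm. 10.2] [cite: Mazur1978, Cor. 4.1] [cite: Miller2011LMS, Def. 1.1] -/
theorem bsdp_of_skinnerZhang13_OPEN_of_mccallum
    -- published named facts
    (hGZ : ∀ (N : ℕ) [NeZero N] (W : WeierstrassCurve ℚ) (K : Type) [Field K] [NumberField K],
      gross_zagier N W K)
    (hKo : ∀ (N : ℕ) [NeZero N] (W : WeierstrassCurve ℚ) (K : Type) [Field K] [NumberField K],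
      kolyvagin N W K)
    (hB : ∀ (N : ℕ) [NeZero N] (W : WeierstrassCurve ℚ) (K : Type) [Field K] [NumberField K],
      Kolyvagin1990_padicValNat_card_sha_le N W K)
    (hSk : Skinner2016.thmC_padicValRat_bsd_rank_zero)
    (hGZK : rank_eq_analyticRank_of_analyticRank_le_one) (hmod : hasEntireLFunction_rat)
    (hnf : exists_isNewformOf) (hHL : HoffsteinLuo1997_exists_twist_L_one_ne_zero)
    (hMaz : mazur_not_dvd_maninConstant_of_odd)
    (hrec : ∀ (N : ℕ) [NeZero N] (W : WeierstrassCurve ℚ) (K : Type) [Field K] [NumberField K],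
      heegnerPointOfConductor_one_galoisConj N W K)
    (hMc : McCallum1991_pow_dvd_card_sha_primary_of_certificate)
    -- THE OPEN CLAIM, by Literature name
    (hSZ : SkinnerZhang2014.thm1_3_exists_kolyvaginClass_one_ne_zero_OPEN)
    -- the pair
    (W : WeierstrassCurve ℚ) [W.IsElliptic] [W.IsGloballyMinimal] (p : ℕ) [Fact p.Prime]
    (hX : ClassX11b W p) (hp5 : 5 ≤ p)
    (hfin : ¬ p ∣ padicValInt p W.minimalDiscriminantInt)
    (hlog : W.HasSplitMultiplicativeReductionAtPrime p →
      ∀ D : TateParameterData W p, (padicLog p D.q).valuation = 1)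
    (hramAll : ∀ (ℓ : ℕ) [Fact ℓ.Prime], ℓ ≠ p → W.HasMultiplicativeReductionAtPrime ℓ →
      ¬ p ∣ padicValInt ℓ W.minimalDiscriminantInt)
    (hram : Ram W p) (htam : ¬ p ∣ W.tamagawaProduct) : BSDp W p := by
  have hp : p.Prime := Fact.out
  haveI : NeZero (W.conductorNorm ℤ) := ⟨(W.conductorNorm_pos_holds).ne'⟩
  obtain ⟨hr, hp2, hmult, hirr⟩ := hX
  have hρ : Surj W p := surj_of_irr_of_ram W p hirr hram
  -- the Hoffstein–Luo admissible field
  have hw : W.rootNumber = -1 := by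
    rw [WeierstrassCurve.rootNumber_eq_neg_one_pow_analyticRank_of_exists_isNewformOf hnf W, hr]
    norm_num
  obtain ⟨K, _, _, hK, hodd, hlt, hHN, hHp, hLt⟩ :=
    exists_admissibleField_of_rootNumber_eq_neg_one hnf hHL W hw p
  have h3 : NumberField.discr K ≠ -3 := by omega
  have h4 : NumberField.discr K ≠ -4 := by omega
  have hμ : ¬ p ∣ Units.torsionOrder K := by
    haveI : IsTotallyComplex K := hK.2
    rw [Literature.NumberTheory.DiophantineGeometry.torsionOrder_eq_two_of_discr_lt hK.1 hlt]
    intro h2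
    have := Nat.le_of_dvd two_pos h2
    omega
  -- SZ14 Thm 1.3 at this field: a frame (Dt', β', ι') and a non-zero Kolyvagin class c_1(n)
  obtain ⟨Dt', β', ι', n, d, hn, -, hne⟩ :=
    hSZ W p hp5 hmult hirr hfin hlog (fun ℓ _ hℓ hm ↦ hramAll ℓ hℓ hm) hram K hK hHN
  -- a Heegner datum with the witness orientation, the witness Heegner point y_K' ∈ E(K)
  obtain ⟨H', hH'β⟩ := exists_heegnerDatum (W.conductorNorm ℤ) hK.discr_neg d.dvd_sq_sub
  obtain ⟨P', hP'⟩ := heegnerPointComplex_mem_range_map_holds (W.conductorNorm ℤ) W K hK hHN Dt' H' ι'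
  -- a Manin-good datum at the same level, its Heegner point y_K ∈ E(K) for the same (β', ι')
  obtain ⟨Dt, hc⟩ := exists_modularParametrizationData_not_dvd hnf hMaz
    integral_neronScaling_of_isGloballyMinimal_holds W rfl hp hp2
    (not_sq_dvd_conductorNorm_of_mult (W := W) (p := p) hmult) hirr
  obtain ⟨P, hP⟩ := heegnerPointComplex_mem_range_map_holds (W.conductorNorm ℤ) W K hK hHN Dt H' ι'
  -- proportionality: Dt.c • P' = Dt'.c • P in E(K)
  have hprop : Dt'.c • P = Dt.c • P' := by
    apply WeierstrassCurve.Affine.Point.map_injective (W' := W) (f := ι'.toRatAlgHom)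
    rw [map_zsmul, map_zsmul, hP, hP',
      ModularParametrizationData.zsmul_heegnerPointComplex_eq Dt Dt' H']
  -- both points have infinite order (Gross–Zagier at r_an = 1 with L(E^{d_K},1) ≠ 0)
  have hPinf : ¬ IsOfFinAddOrder P :=
    not_isOfFinAddOrder_of_heegner_of_analyticRank_eq_one W (W.conductorNorm ℤ) K Dt H' ι' P
      (hGZ _ W K) hmod hr hK hHN hLt hP
  have hP'inf : ¬ IsOfFinAddOrder P' :=
    not_isOfFinAddOrder_of_heegner_of_analyticRank_eq_one W (W.conductorNorm ℤ) K Dt' H' ι' P'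
      (hGZ _ W K) hmod hr hK hHN hLt hP'
  -- rank one and finite Ш(E/K) (Kolyvagin at the non-torsion Heegner point)
  obtain ⟨hrank, hSha⟩ := hKo (W.conductorNorm ℤ) W K hK hHN ⟨Dt', H', ι', hP'⟩ hP'inf
  haveI : Finite (W.baseChange K).sha := hSha
  -- E(K)[p] = 0
  have hbot := torsionBy_eq_bot_of_isImaginaryQuadratic_of_hasIrreducibleModPGaloisRep W K hK hp hirr
  have hiv : ∀ x : (W.baseChange K).toAffine.Point, p • x = 0 → x = 0 := fun x hx ↦ by
    have hmem : x ∈ AddSubgroup.torsionBy (W.baseChange K).toAffine.Point ((p : ℕ) : ℤ) := by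
      rw [mem_torsionBy_iff, natCast_zsmul]
      exact hx
    rw [hbot] at hmem
    exact hmem
  -- p^{M₀} ∥ y_K' (Mordell–Weil)
  haveI : Module.Finite ℤ (W.baseChange K).toAffine.Point := (W.baseChange K).module_finite_point_holds
  obtain ⟨M₀, x₀, hx₀, hmax⟩ := exists_pow_smul_eq_and_forall_ne hP'inf (p := p) hp.two_le
  have hdiv : ∃ Q : (W.baseChange K).toAffine.Point, ((p ^ M₀ : ℕ) : ℤ) • Q = P' :=
    ⟨x₀, by rw [natCast_zsmul]; exact hx₀⟩
  have hndiv : ¬ ∃ Q : (W.baseChange K).toAffine.Point, ((p ^ (M₀ + 1) : ℕ) : ℤ) • Q = P' := by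
    rintro ⟨Q, hQ⟩
    exact hmax Q (by rw [← natCast_zsmul]; exact hQ)
  -- the conductor-1 Kolyvagin–Heegner datum on the witness frame (Gross §3, Literature theorems)
  obtain ⟨d₁⟩ := Summit.BirchSwinnertonDyer.BirchSwinnertonDyer.Theorems.kolyvaginRoadThree_towerData_of_grossCM
    (fun N _ W K _ _ ↦ phi_heegnerPointOfConductor_mem_range_map_ringClassField_holds N W K)
    (fun _ _ _ ↦ exists_generator_ringClassGalOver_holds) W K Dt' β' ι' 1 hK hHN d.dvd_sq_sub
    squarefree_one (by simp)
  have hP'd : d₁.toGeomPoints d₁.derivedPoint = toGeomPoints (W.baseChange K) P' :=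
    KolyvaginBottom.toGeomPoints_derivedPoint_one_eq (hrec _ W K) hK hHN hP' d₁ hH'β
  -- non-CM, tower surjectivity
  have hCM : ¬ W.HasCM := not_hasCM_of_hasMultiplicativeReductionAtPrime' W hmult
  have hsurj : ∀ m : ℕ, W.HasSurjectiveModNGaloisRep (p ^ m : ℕ) :=
    hasSurjectiveModNGaloisRep_pow_of_hasMultiplicativeReductionAtPrime W p hρ hram
  -- STEP L at the witness point (McCallum), transported to the Manin-good frame
  have hL' : IndexLowerBoundAt W p K P' :=
    indexLowerBoundAt_of_kolyvaginClass_one_ne_zero_of_mccallum W K hMc hCM hK h3 h4 hHN p hp2 hsurj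
      Dt' β' ι' d₁ P' hP'd hP'inf hrank hiv hdiv hndiv d hn hne
  have hL : IndexLowerBoundAt W p K P :=
    indexLowerBoundAt_of_zsmul_eq_zsmul hprop hc Dt'.maninConstant_ne_zero_holds hPinf hP'inf hL'
  -- a globally minimal model of the twist, and the rigidity theorem
  have hD0 : (NumberField.discr K : ℚ) ≠ 0 := by exact_mod_cast NumberField.discr_ne_zero K
  haveI hEt : (W.quadraticTwist (NumberField.discr K : ℚ)).IsElliptic := W.isElliptic_quadraticTwist hD0
  obtain ⟨Cd, hCd⟩ := hasGlobalMinimalModel_rat_holds (W.quadraticTwist (NumberField.discr K : ℚ))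
  haveI := hCd
  exact bsdp_of_indexLowerBoundAt_of_heegnerData_of_odd W p K Dt H' ι' P (hGZ _ W K) (hKo _ W K)
    (hB _ W K) hSk hGZK hmod ⟨hr, hp2, hmult, hirr⟩ hram htam hK hodd hHN hP hc hμ hLt
    (Cd • W.quadraticTwist (NumberField.discr K : ℚ)) Cd rfl hL

/-! ### §3 In route p2's currency: THE open input on the same locus, given the control identity -/

/-- **Corollary in the K2 route's currency**: under the same hypotheses plus the PUB-shaped control identity
`P2ControlOnTreeAt W p` (Castella 2018 Thm. 2.3 ∕ JSW Thm. 3.3.1 on the constructed `X_ac`; its `≤` half is a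
tree theorem, its `≥` half route R1's atom (P11) — hypothesis shape, as in `P2.openInputOnTreeAt_of_bsdp_of_ram`),
THE open input `X11b.P2OpenInputOnTreeAt W p` holds — by tightness from §2's `BSDp W p`. CONDITIONAL on `hSZ`,
`hMc`, `hC`; nothing booked. [claim: SkinnerZhang2014, status: under-review]
[cite: Castella2018, Thm. 2.3 (p. 5), Thm. 3.2 (p. 9)] [cite: JetchevSkinnerWan2017, Thm. 3.3.1, §7.4.1] -/
theorem openInputOnTreeAt_of_skinnerZhang13_OPEN_of_mccallum_of_control
    (hGZ : ∀ (N : ℕ) [NeZero N] (W : WeierstrassCurve ℚ) (K : Type) [Field K] [NumberField K],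
      gross_zagier N W K)
    (hKo : ∀ (N : ℕ) [NeZero N] (W : WeierstrassCurve ℚ) (K : Type) [Field K] [NumberField K],
      kolyvagin N W K)
    (hB : ∀ (N : ℕ) [NeZero N] (W : WeierstrassCurve ℚ) (K : Type) [Field K] [NumberField K],
      Kolyvagin1990_padicValNat_card_sha_le N W K)
    (hSk : Skinner2016.thmC_padicValRat_bsd_rank_zero)
    (hGZK : rank_eq_analyticRank_of_analyticRank_le_one) (hmod : hasEntireLFunction_rat)
    (hnf : exists_isNewformOf) (hHL : HoffsteinLuo1997_exists_twist_L_one_ne_zero)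
    (hMaz : mazur_not_dvd_maninConstant_of_odd)
    (hrec : ∀ (N : ℕ) [NeZero N] (W : WeierstrassCurve ℚ) (K : Type) [Field K] [NumberField K],
      heegnerPointOfConductor_one_galoisConj N W K)
    (hMc : McCallum1991_pow_dvd_card_sha_primary_of_certificate)
    (hSZ : SkinnerZhang2014.thm1_3_exists_kolyvaginClass_one_ne_zero_OPEN)
    (W : WeierstrassCurve ℚ) [W.IsElliptic] [W.IsGloballyMinimal] (p : ℕ) [Fact p.Prime]
    (hX : ClassX11b W p) (hp5 : 5 ≤ p)
    (hfin : ¬ p ∣ padicValInt p W.minimalDiscriminantInt)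
    (hlog : W.HasSplitMultiplicativeReductionAtPrime p →
      ∀ D : TateParameterData W p, (padicLog p D.q).valuation = 1)
    (hramAll : ∀ (ℓ : ℕ) [Fact ℓ.Prime], ℓ ≠ p → W.HasMultiplicativeReductionAtPrime ℓ →
      ¬ p ∣ padicValInt ℓ W.minimalDiscriminantInt)
    (hram : Ram W p) (htam : ¬ p ∣ W.tamagawaProduct)
    (hC : P2ControlOnTreeAt W p) : P2OpenInputOnTreeAt W p :=
  P2.openInputOnTreeAt_of_bsdp_of_ram W p hGZ hKo hSk hGZK hmod hC hram
    (bsdp_of_skinnerZhang13_OPEN_of_mccallum hGZ hKo hB hSk hGZK hmod hnf hHL hMaz hrec hMc hSZ W p hX hp5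
      hfin hlog hramAll hram htam)

/-! ### §4 The Tamagawa hypothesis is implied: the theorem on SZ14 Thm 1.3's printed hypotheses alone -/

/-- **`p ∤ ∏ c_ℓ` follows from Thm. 1.3's hypotheses at `p ≥ 5`** (♠(2): every multiplicative `ℓ ≠ p` has
`p ∤ v_ℓ(Δ_min)`; (c): `p ∤ v_p(Δ_min)`): a prime `p ≥ 5` divides `∏ c_ℓ` only through a SPLIT multiplicative
`ℓ` with `p ∣ v_ℓ(Δ_min) = c_ℓ` (`not_dvd_tamagawaProduct_of_forall_split`; additive `c_ℓ ≤ 4`, non-split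
`c_ℓ ≤ 2`). [cite: SilvermanATAEC1994, Cor. IV.9.2(d)] -/
theorem not_dvd_tamagawaProduct_of_szHypotheses (W : WeierstrassCurve ℚ) [W.IsElliptic]
    [W.IsGloballyMinimal] {p : ℕ} (hp : p.Prime) (hp5 : 5 ≤ p)
    (hfin : ¬ p ∣ padicValInt p W.minimalDiscriminantInt)
    (hramAll : ∀ (ℓ : ℕ) [Fact ℓ.Prime], ℓ ≠ p → W.HasMultiplicativeReductionAtPrime ℓ →
      ¬ p ∣ padicValInt ℓ W.minimalDiscriminantInt) :
    ¬ p ∣ W.tamagawaProduct := by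
  refine not_dvd_tamagawaProduct_of_forall_split W hp hp5 fun ℓ _ hs ↦ ?_
  by_cases hℓ : ℓ = p
  · subst hℓ; exact hfin
  · exact hramAll ℓ hℓ hs.hasMultiplicativeReductionAtPrime

/-- **B9 at `p ≥ 5`, FINAL FORM: `BSD(E,p)` for every X11b pair satisfying the PRINTED hypotheses of
Skinner–Zhang 2014 Thm. 1.3 at `N⁻ = 1`** (`5 ≤ p`; `ρ̄` not finite at `p` + the split `𝓛`-clause; every
multiplicative `ℓ ≠ p` E[p]-ramified; a (ram) witness) — from the OPEN Literature binder (Thm. 1.3, ∃-framed)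
+ McCallum 1991 + the published inputs; the Tamagawa condition of §2 is discharged by §4's lemma.
CONDITIONAL on `hSZ` (PRE) and `hMc`; nothing booked. [claim: SkinnerZhang2014, status: under-review]
[cite: McCallumLMS1991, §5 Cor. 5.6 (p. 310)] [cite: Miller2011LMS, Def. 1.1] -/
theorem bsdp_of_skinnerZhang13_OPEN_of_mccallum'
    (hGZ : ∀ (N : ℕ) [NeZero N] (W : WeierstrassCurve ℚ) (K : Type) [Field K] [NumberField K],
      gross_zagier N W K)
    (hKo : ∀ (N : ℕ) [NeZero N] (W : WeierstrassCurve ℚ) (K : Type) [Field K] [NumberField K],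
      kolyvagin N W K)
    (hB : ∀ (N : ℕ) [NeZero N] (W : WeierstrassCurve ℚ) (K : Type) [Field K] [NumberField K],
      Kolyvagin1990_padicValNat_card_sha_le N W K)
    (hSk : Skinner2016.thmC_padicValRat_bsd_rank_zero)
    (hGZK : rank_eq_analyticRank_of_analyticRank_le_one) (hmod : hasEntireLFunction_rat)
    (hnf : exists_isNewformOf) (hHL : HoffsteinLuo1997_exists_twist_L_one_ne_zero)
    (hMaz : mazur_not_dvd_maninConstant_of_odd)
    (hrec : ∀ (N : ℕ) [NeZero N] (W : WeierstrassCurve ℚ) (K : Type) [Field K] [NumberField K],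
      heegnerPointOfConductor_one_galoisConj N W K)
    (hMc : McCallum1991_pow_dvd_card_sha_primary_of_certificate)
    (hSZ : SkinnerZhang2014.thm1_3_exists_kolyvaginClass_one_ne_zero_OPEN)
    (W : WeierstrassCurve ℚ) [W.IsElliptic] [W.IsGloballyMinimal] (p : ℕ) [Fact p.Prime]
    (hX : ClassX11b W p) (hp5 : 5 ≤ p)
    (hfin : ¬ p ∣ padicValInt p W.minimalDiscriminantInt)
    (hlog : W.HasSplitMultiplicativeReductionAtPrime p →
      ∀ D : TateParameterData W p, (padicLog p D.q).valuation = 1)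
    (hramAll : ∀ (ℓ : ℕ) [Fact ℓ.Prime], ℓ ≠ p → W.HasMultiplicativeReductionAtPrime ℓ →
      ¬ p ∣ padicValInt ℓ W.minimalDiscriminantInt)
    (hram : Ram W p) : BSDp W p :=
  bsdp_of_skinnerZhang13_OPEN_of_mccallum hGZ hKo hB hSk hGZK hmod hnf hHL hMaz hrec hMc hSZ W p hX hp5 hfin
    hlog hramAll hram (not_dvd_tamagawaProduct_of_szHypotheses W (Fact.out) hp5 hfin hramAll)

end Summit.BirchSwinnertonDyer.Rank1Residual.X11b.Three.Koly

end
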